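import Literature.Topology.FourManifolds.IwaseToriZoneH
import Literature.Topology.FourManifolds.IwaseModelMaps
import Literature.Topology.FourManifolds.FramedTubularNbhd
import HarnessLib

/-!
# The first Iwase torus: the tubular neighbourhood map `T₀` of `Σ₀`

Part of the proof of Iwase's Proposition 3.5 [cite: Iwase1988, Prop. 3.5, p. 296].  The graph
zone map `TV` and the handle zone map `TH` are glued along the loop coordinate `t ∈ ℝ/4ℤ` of the
second circle factor (`t_B = 4(angB - 1)` near the equator heights, `t_A = 4 angA` near the top of
the handle): the *half-torus map* `Nmap` (graph zone below the switching height `tSw`, handle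
zone above; smooth by the overlap identity) parametrises the upper half `t ∈ (-tSw, 2]`, and the
lower half is its **mirror** (`mirrorM`, using the local symmetry `loopU (4 - t) = 1 - loopU t`
about the top of the handle and `TV (z, -t, ν) = mirror (TV (z, t, ν))`).

* `T0pre : T² × ℝ² → S² × ℝ²`, its four local forms, `isLocalDiffeomorph_T0pre` (everything by
  composition of partial diffeomorphisms: angle charts `angAPD`/`angBPD`, `isLocalDiffeomorphAt_coord`);
* `T0pre_core_injective` (graph-type and handle-type core points are separated by `‖w‖ ≶ tSw²`),
  `exists_injOn_T0pre` (Hirsch's point-set lemma `exists_injOn_prod_ball`);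
* the squeeze `sqz F ε (x, v) = F (x, univBall 0 ε v)` and `isSmoothEmbedding_sqz`
  (`isSmoothEmbedding_of_isLocalDiffeomorph`);
* `range_T0pre_core : range (T0pre (·, 0)) = Σ₀` and `T0pre_not_mem`.

All statements are elementary [folklore].

## References
* Z. Iwase, *Dehn-surgery along a torus T²-knot*, Pacific J. Math. 133 (1988), 289–299,
  Prop. 3.5. [cite: Iwase1988]
* M. W. Hirsch, *Differential Topology* (1976), Ch. 4, Thm. 5.1 (tubular neighbourhoods).
-/

open scoped ContDiff Topology Manifold
open Set Function Real Filter Metric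

noncomputable section

namespace Literature.Topology.FourManifolds

namespace IwaseTori

open IwaseHandle UnknotSurgery

/-! ### The mirror of the ambient manifold -/

/-- The mirror `x₂ ↦ -x₂` of the sphere is smooth. [folklore] -/
theorem contMDiff_mirrorS2 : ContMDiff (𝓡 2) (𝓡 2) ∞ mirrorS2 := by
  have h : ContDiff ℝ ∞ fun v : EuclideanSpace ℝ (Fin 3) =>
      (WithLp.toLp 2 ![v 0, v 1, -v 2] : EuclideanSpace ℝ (Fin 3)) := by
    apply PiLp.contDiff_toLp.comp
    rw [contDiff_pi]
    intro i
    fin_cases i <;> simp <;> fun_prop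
  haveI := Fact.mk (@finrank_euclideanSpace_fin ℝ _ (2 + 1))
  have h2 : ContMDiff (𝓡 2) 𝓘(ℝ, EuclideanSpace ℝ (Fin 3)) ∞
      fun p : sphere (0 : EuclideanSpace ℝ (Fin 3)) 1 => (WithLp.toLp 2 ![(p : EuclideanSpace ℝ (Fin 3)) 0,
        (p : EuclideanSpace ℝ (Fin 3)) 1, -(p : EuclideanSpace ℝ (Fin 3)) 2] : EuclideanSpace ℝ (Fin 3)) :=
    h.comp_contMDiff contMDiff_coe_sphere
  exact h2.codRestrict_sphere fun p => (mirrorS2 p).2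

/-- **The mirror of `S² × ℝ²`**: `(P, w) ↦ (mirror P, w)`. [folklore] -/
def mirrorM (q : sphere (0 : EuclideanSpace ℝ (Fin 3)) 1 × EuclideanSpace ℝ (Fin 2)) :
    sphere (0 : EuclideanSpace ℝ (Fin 3)) 1 × EuclideanSpace ℝ (Fin 2) := (mirrorS2 q.1, q.2)

/-- `mirrorM` is an involution. [folklore] -/
@[simp] theorem mirrorM_mirrorM (q : sphere (0 : EuclideanSpace ℝ (Fin 3)) 1 × EuclideanSpace ℝ (Fin 2)) :
    mirrorM (mirrorM q) = q := by
  simp [mirrorM]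

/-- The plane coordinate of the mirror. [folklore] -/
@[simp] theorem mirrorM_snd (q : sphere (0 : EuclideanSpace ℝ (Fin 3)) 1 × EuclideanSpace ℝ (Fin 2)) :
    (mirrorM q).2 = q.2 := rfl

/-- The spherical coordinate of the mirror. [folklore] -/
@[simp] theorem mirrorM_fst (q : sphere (0 : EuclideanSpace ℝ (Fin 3)) 1 × EuclideanSpace ℝ (Fin 2)) :
    (mirrorM q).1 = mirrorS2 q.1 := rfl

/-- `mirrorM` is injective. [folklore] -/
theorem mirrorM_injective : Injective mirrorM := fun a b h => by
  rw [← mirrorM_mirrorM a, h, mirrorM_mirrorM]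

/-- **The mirror as a diffeomorphism.** [folklore] -/
def mirrorDiffeo : (sphere (0 : EuclideanSpace ℝ (Fin 3)) 1 × EuclideanSpace ℝ (Fin 2)) ≃ₘ⟮
    (𝓡 2).prod 𝓘(ℝ, EuclideanSpace ℝ (Fin 2)), (𝓡 2).prod 𝓘(ℝ, EuclideanSpace ℝ (Fin 2))⟯
    (sphere (0 : EuclideanSpace ℝ (Fin 3)) 1 × EuclideanSpace ℝ (Fin 2)) where
  toFun := mirrorM
  invFun := mirrorM
  left_inv := mirrorM_mirrorM
  right_inv := mirrorM_mirrorM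
  contMDiff_toFun := contMDiff_mirrorS2.prodMap contMDiff_id
  contMDiff_invFun := contMDiff_mirrorS2.prodMap contMDiff_id

/-- `mirrorDiffeo` is `mirrorM`. [folklore] -/
@[simp] theorem mirrorDiffeo_apply (q : sphere (0 : EuclideanSpace ℝ (Fin 3)) 1 × EuclideanSpace ℝ (Fin 2)) :
    mirrorDiffeo q = mirrorM q := rfl

/-- The graph-zone mirror symmetry in `mirrorM` form. [folklore] -/
theorem TV_neg' {z : sphere (0 : EuclideanSpace ℝ (Fin 2)) 1} {t : ℝ} {ν : ℂ} (ht : zoneV t)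
    (hν : ‖ν‖ ≤ nuMax) : TV (z, -t, ν) = mirrorM (TV (z, t, ν)) := TV_neg ht hν

/-! ### The local symmetry of the loop parametrisation about the top of the handle -/

/-- On `[11/10, 29/10]` the loop parametrisation is the affine middle germ. [folklore] -/
theorem loopU_eq_sigM {t : ℝ} (h1 : 11 / 10 ≤ t) (h2 : t ≤ 29 / 10) : loopU t = sigM t := by
  rw [loopU, cut_of_ge (by norm_num) (by linarith : (19 / 20 : ℝ) ≤ t), loopU1,
    cut_of_ge (by norm_num) h1, loopU2, cut_of_le (by norm_num) h2]
  ring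

/-- **Local symmetry**: `loopU (4 - t) = 1 - loopU t` for `t ∈ [11/10, 29/10]`. [folklore] -/
theorem loopU_four_sub {t : ℝ} (h1 : 11 / 10 ≤ t) (h2 : t ≤ 29 / 10) : loopU (4 - t) = 1 - loopU t := by
  rw [loopU_eq_sigM (by linarith) (by linarith), loopU_eq_sigM h1 h2, sigM, sigM]; ring

/-- The mirror of a handle-zone point is the handle point with parameter `1 - u`. [folklore] -/
theorem mirrorM_TH (z : sphere (0 : EuclideanSpace ℝ (Fin 2)) 1) (t : ℝ) (ν : ℂ) :
    mirrorM (TH (z, t, ν)) = handleMap (1 - loopU t, (GH (z, t, ν)).2) := by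
  have h := handleMap_one_sub (loopU t) (GH (z, t, ν)).2.1 (GH (z, t, ν)).2.2
  simp only [Prod.mk.eta] at h
  rw [h]
  rfl

/-- **The handle-zone map near the top of the handle is mirror-symmetric**:
`TH (z, 4 - t, ν) = mirror (TH (z, t, ν))` for `t ∈ [11/10, 29/10]`. [folklore] -/
theorem TH_four_sub {z : sphere (0 : EuclideanSpace ℝ (Fin 2)) 1} {t : ℝ} (h1 : 11 / 10 ≤ t)
    (h2 : t ≤ 29 / 10) (ν : ℂ) : TH (z, 4 - t, ν) = mirrorM (TH (z, t, ν)) := by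
  rw [mirrorM_TH]
  change handleMap (loopU (4 - t), tube (mfun (loopU (4 - t))) (toC (z : EuclideanSpace ℝ (Fin 2))) (nprime ν)) =
    handleMap (1 - loopU t, tube (mfun (loopU t)) (toC (z : EuclideanSpace ℝ (Fin 2))) (nprime ν))
  rw [loopU_four_sub h1 h2, mfun_one_sub]

/-! ### The half-torus map: graph zone glued to handle zone -/

/-- The switching height between the graph zone and the handle zone. [folklore] -/
def tSw : ℝ := 1981 / 2000

/-- **The half-torus map**: graph zone below the switching height, handle zone above.
[folklore] -/
def Nmap (p : sphere (0 : EuclideanSpace ℝ (Fin 2)) 1 × ℝ × ℂ) :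
    sphere (0 : EuclideanSpace ℝ (Fin 3)) 1 × EuclideanSpace ℝ (Fin 2) :=
  if p.2.1 < tSw then TV p else TH p

/-- `√(49/50) < tSw`, numerically. [folklore] -/
theorem sqrt_lt_tSw : Real.sqrt (49 / 50) < tSw := by
  rw [tSw, Real.sqrt_lt' (by norm_num)]; norm_num

/-- `tSw` is in the graph zone. [folklore] -/
theorem zoneV_tSw : zoneV tSw := by unfold zoneV tSw; norm_num

/-- Below the switching height and above `√(49/50)`... any `t < tSw` with `√(49/50) < t` or in the
graph zone is in the graph zone; precisely `t < tSw → -tSw < t → zoneV t`. [folklore] -/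
theorem zoneV_of_abs_lt {t : ℝ} (h : |t| < tSw) : zoneV t := by
  unfold zoneV; unfold tSw at h
  have := abs_lt.1 h
  nlinarith

/-- **Near a graph-zone point the half-torus map is the graph-zone map.** [folklore] -/
theorem Nmap_eventuallyEq_TV {p : sphere (0 : EuclideanSpace ℝ (Fin 2)) 1 × ℝ × ℂ} (ht : zoneV p.2.1)
    (hν : ‖p.2.2‖ < nuMax) : Nmap =ᶠ[𝓝 p] TV := by
  have ho : IsOpen {q : sphere (0 : EuclideanSpace ℝ (Fin 2)) 1 × ℝ × ℂ | zoneV q.2.1 ∧ ‖q.2.2‖ < nuMax} := by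
    refine IsOpen.inter ?_ (isOpen_lt (continuous_norm.comp (continuous_snd.comp continuous_snd)) continuous_const)
    exact isOpen_lt ((continuous_pow 2).comp (continuous_fst.comp continuous_snd)) continuous_const
  filter_upwards [ho.mem_nhds ⟨ht, hν⟩] with q hq
  obtain ⟨z, t, ν⟩ := q
  obtain ⟨hV, hn⟩ := hq
  by_cases h : t < tSw
  · simp [Nmap, h]
  · simp only [Nmap, h, if_false]
    push Not at h
    exact TH_eq_TV (lt_of_lt_of_le sqrt_lt_tSw h) hV hn.le

/-- **Near a handle-zone point above `√(49/50)` the half-torus map is the handle-zone map.**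
[folklore] -/
theorem Nmap_eventuallyEq_TH {p : sphere (0 : EuclideanSpace ℝ (Fin 2)) 1 × ℝ × ℂ}
    (ht : Real.sqrt (49 / 50) < p.2.1) (hν : ‖p.2.2‖ < nuMax) : Nmap =ᶠ[𝓝 p] TH := by
  have ho : IsOpen {q : sphere (0 : EuclideanSpace ℝ (Fin 2)) 1 × ℝ × ℂ |
      Real.sqrt (49 / 50) < q.2.1 ∧ ‖q.2.2‖ < nuMax} :=
    (isOpen_lt continuous_const (continuous_fst.comp continuous_snd)).inter
      (isOpen_lt (continuous_norm.comp (continuous_snd.comp continuous_snd)) continuous_const)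
  filter_upwards [ho.mem_nhds ⟨ht, hν⟩] with q hq
  obtain ⟨z, t, ν⟩ := q
  obtain ⟨hH, hn⟩ := hq
  by_cases h : t < tSw
  · simp only [Nmap, h, if_true]
    have hV : zoneV t := zoneV_of_abs_lt (by
      rw [abs_lt]; exact ⟨by linarith [Real.sqrt_nonneg (49 / 50), tSw.eq_def ▸ (show (0:ℝ) < 1981/2000 by norm_num)], h⟩)
    exact (TH_eq_TV hH hV hn.le).symm
  · simp [Nmap, h]

/-- The good set of the half-torus map: graph or handle zone, `‖ν‖ < ν_max`, and (for the handle
zone) below `t = 3` (we only use the half torus up to the top of the handle). [folklore] -/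
def NGood (p : sphere (0 : EuclideanSpace ℝ (Fin 2)) 1 × ℝ × ℂ) : Prop :=
  (zoneV p.2.1 ∨ zoneH p.2.1) ∧ ‖p.2.2‖ < nuMax

/-- **The half-torus map is a local diffeomorphism on its good set.** [folklore] -/
theorem isLocalDiffeomorphAt_Nmap {p : sphere (0 : EuclideanSpace ℝ (Fin 2)) 1 × ℝ × ℂ} (hp : NGood p) :
    IsLocalDiffeomorphAt ((𝓡 1).prod 𝓘(ℝ, ℝ × ℂ)) ((𝓡 2).prod 𝓘(ℝ, EuclideanSpace ℝ (Fin 2))) ∞ Nmap p := by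
  obtain ⟨hz | hz, hν⟩ := hp
  · exact isLocalDiffeomorphAt_congr_nhds' (isLocalDiffeomorphAt_TV (xiV_mem_Ioo hz hν.le) hν)
      (Nmap_eventuallyEq_TV hz hν)
  · exact isLocalDiffeomorphAt_congr_nhds' (isLocalDiffeomorphAt_TH hz hν) (Nmap_eventuallyEq_TH hz.1 hν)

/-- Values: below the switch the half-torus map is `TV`. [folklore] -/
theorem Nmap_of_lt {p : sphere (0 : EuclideanSpace ℝ (Fin 2)) 1 × ℝ × ℂ} (h : p.2.1 < tSw) : Nmap p = TV p := by
  simp [Nmap, h]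

/-- Values: above the switch the half-torus map is `TH`. [folklore] -/
theorem Nmap_of_le {p : sphere (0 : EuclideanSpace ℝ (Fin 2)) 1 × ℝ × ℂ} (h : tSw ≤ p.2.1) : Nmap p = TH p := by
  simp [Nmap, not_lt.2 h]

/-! ### Loop coordinates of the second circle factor -/

/-- **The loop coordinate of the first chart**: `t_A = 4 · angA ∈ (0, 4]`, smooth off `ptA`.
[folklore] -/
def tA (z : sphere (0 : EuclideanSpace ℝ (Fin 2)) 1) : ℝ := 4 * angA z

/-- **The loop coordinate of the second chart**: `t_B = 4 (angB - 1) ∈ (-2, 2]`, smooth off `ptB`.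
[folklore] -/
def tB (z : sphere (0 : EuclideanSpace ℝ (Fin 2)) 1) : ℝ := 4 * (angB z - 1)

/-- `t_A ∈ (0, 4]`. [folklore] -/
theorem tA_mem (z : sphere (0 : EuclideanSpace ℝ (Fin 2)) 1) : tA z ∈ Ioc (0 : ℝ) 4 := by
  have := angA_mem_Ioc z; unfold tA; exact ⟨by linarith [this.1], by linarith [this.2]⟩

/-- `t_B ∈ (-2, 2]`. [folklore] -/
theorem tB_mem (z : sphere (0 : EuclideanSpace ℝ (Fin 2)) 1) : tB z ∈ Ioc (-2 : ℝ) 2 := by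
  have := angB_mem_Ioc z; unfold tB; exact ⟨by linarith [this.1], by linarith [this.2]⟩

/-- `angA z = 1/2 ↔ z = ptB`. [folklore] -/
theorem angA_eq_half_iff (z : sphere (0 : EuclideanSpace ℝ (Fin 2)) 1) : angA z = 1 / 2 ↔ z = ptB := by
  constructor
  · intro h; rw [← circlePt_angA z, h]; rfl
  · rintro rfl
    have : (ptB : sphere (0 : EuclideanSpace ℝ (Fin 2)) 1) = circlePt (1 / 2) := rfl
    rw [this, angA_circlePt (by norm_num)]

/-- `angA z = 1 ↔ z = ptA`. [folklore] -/
theorem angA_eq_one_iff (z : sphere (0 : EuclideanSpace ℝ (Fin 2)) 1) : angA z = 1 ↔ z = ptA := by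
  constructor
  · intro h
    have h1 : circlePt 1 = circlePt 0 := by have := circlePt_add_one 0; rwa [zero_add] at this
    rw [← circlePt_angA z, h, h1]
    rfl
  · rintro rfl
    rw [angA, (eq_ptA_iff ptA).1 rfl, Complex.arg_neg_one]
    field_simp
    ring

/-- `t_B = t_A` on the upper half (`angA < 1/2`). [folklore] -/
theorem tB_eq_tA_of_lt {z : sphere (0 : EuclideanSpace ℝ (Fin 2)) 1} (h : angA z < 1 / 2) : tB z = tA z := by
  have hA : z ≠ ptA := fun h' => by rw [(angA_eq_one_iff z).2 h'] at h; norm_num at h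
  have hB : z ≠ ptB := fun h' => by rw [(angA_eq_half_iff z).2 h'] at h; norm_num at h
  rcases angB_eq_of_ne hA hB with ⟨_, h2⟩ | ⟨h1, _⟩
  · rw [tB, tA, h2]; ring
  · linarith

/-- `t_B = t_A - 4` on the lower half (`1/2 < angA < 1`). [folklore] -/
theorem tB_eq_tA_sub_of_gt {z : sphere (0 : EuclideanSpace ℝ (Fin 2)) 1} (h : 1 / 2 < angA z) (hA : z ≠ ptA) :
    tB z = tA z - 4 := by
  have hB : z ≠ ptB := fun h' => by rw [(angA_eq_half_iff z).2 h'] at h; norm_num at h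
  rcases angB_eq_of_ne hA hB with ⟨h1, _⟩ | ⟨_, h2⟩
  · linarith
  · rw [tB, tA, h2]; ring

/-- `t_A (ptB) = 2`. [folklore] -/
@[simp] theorem tA_ptB : tA ptB = 2 := by
  rw [tA, (angA_eq_half_iff ptB).2 rfl]; norm_num

/-- `t_B (ptB) = 2`. [folklore] -/
@[simp] theorem tB_ptB : tB ptB = 2 := by
  rw [tB, angB, (eq_ptB_iff ptB).1 rfl, Complex.arg_neg_one]
  field_simp
  ring

/-- `t_B (ptA) = 0`. [folklore] -/
@[simp] theorem tB_ptA : tB ptA = 0 := by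
  rw [tB, angB, (eq_ptA_iff ptA).1 rfl, Complex.arg_one]
  ring

/-- `t_A` is smooth off `ptA`. [folklore] -/
theorem contMDiffAt_tA {z : sphere (0 : EuclideanSpace ℝ (Fin 2)) 1} (hz : z ≠ ptA) :
    ContMDiffAt (𝓡 1) 𝓘(ℝ, ℝ) ∞ tA z :=
  ((contDiff_const (c := (4 : ℝ))).mul contDiff_id).contDiffAt.contMDiffAt.comp z (contMDiffAt_angA hz)

/-- `t_B` is smooth off `ptB`. [folklore] -/
theorem contMDiffAt_tB {z : sphere (0 : EuclideanSpace ℝ (Fin 2)) 1} (hz : z ≠ ptB) :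
    ContMDiffAt (𝓡 1) 𝓘(ℝ, ℝ) ∞ tB z :=
  ((contDiff_const (c := (4 : ℝ))).mul (contDiff_id.sub contDiff_const)).contDiffAt.contMDiffAt.comp z
    (contMDiffAt_angB hz)

/-! ### The angle charts as partial diffeomorphisms -/

/-- **The first angle chart** `angA : S¹ ∖ {ptA} ≅ (0, 1)`. [folklore] -/
def angAPD : PartialDiffeomorph (𝓡 1) 𝓘(ℝ, ℝ) (sphere (0 : EuclideanSpace ℝ (Fin 2)) 1) ℝ ∞ where
  toFun := angA
  invFun := circlePt
  source := {z | z ≠ ptA}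
  target := Ioo (0 : ℝ) 1
  map_source' := fun _ hz => angA_mem_Ioo hz
  map_target' := fun θ hθ h => by
    have h1 := angA_circlePt hθ
    rw [(angA_eq_one_iff _).2 h] at h1
    exact absurd hθ.2 (by rw [← h1]; norm_num)
  left_inv' := fun z _ => circlePt_angA z
  right_inv' := fun _ hθ => angA_circlePt hθ
  open_source := isOpen_ne
  open_target := isOpen_Ioo
  contMDiffOn_toFun := fun _ hz => (contMDiffAt_angA hz).contMDiffWithinAt
  contMDiffOn_invFun := contMDiff_circlePt.contMDiffOn

/-- **The second angle chart** `angB : S¹ ∖ {ptB} ≅ (1/2, 3/2)`. [folklore] -/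
def angBPD : PartialDiffeomorph (𝓡 1) 𝓘(ℝ, ℝ) (sphere (0 : EuclideanSpace ℝ (Fin 2)) 1) ℝ ∞ where
  toFun := angB
  invFun := circlePt
  source := {z | z ≠ ptB}
  target := Ioo (1 / 2 : ℝ) (3 / 2)
  map_source' := fun _ hz => angB_mem_Ioo hz
  map_target' := fun θ hθ h => by
    have h1 := angB_circlePt hθ
    have h2 : angB (circlePt θ) = 3 / 2 := by
      rw [h, angB, (eq_ptB_iff ptB).1 rfl, Complex.arg_neg_one]; field_simp; ring
    rw [h2] at h1
    exact absurd hθ.2 (by rw [← h1]; norm_num)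
  left_inv' := fun z _ => circlePt_angB z
  right_inv' := fun _ hθ => angB_circlePt hθ
  open_source := isOpen_ne
  open_target := isOpen_Ioo
  contMDiffOn_toFun := fun _ hz => (contMDiffAt_angB hz).contMDiffWithinAt
  contMDiffOn_invFun := contMDiff_circlePt.contMDiffOn

/-- An affine diffeomorphism of the line. [folklore] -/
def affineDiffeo (a b : ℝ) (ha : a ≠ 0) : ℝ ≃ₘ⟮𝓘(ℝ, ℝ), 𝓘(ℝ, ℝ)⟯ ℝ where
  toFun x := a * x + b
  invFun y := (y - b) / a
  left_inv x := by field_simp; ring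
  right_inv y := by field_simp; ring
  contMDiff_toFun := ((contDiff_const.mul contDiff_id).add contDiff_const).contMDiff
  contMDiff_invFun := ((contDiff_id.sub contDiff_const).div_const _).contMDiff

/-- `t_A` is a local diffeomorphism off `ptA`. [folklore] -/
theorem isLocalDiffeomorphAt_tA {z : sphere (0 : EuclideanSpace ℝ (Fin 2)) 1} (hz : z ≠ ptA) :
    IsLocalDiffeomorphAt (𝓡 1) 𝓘(ℝ, ℝ) ∞ tA z := by
  have h1 := angAPD.isLocalDiffeomorphAt _ _ _ (show z ∈ angAPD.source from hz)
  have h2 := (affineDiffeo 4 0 (by norm_num)).isLocalDiffeomorph (angAPD z)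
  have h := IsLocalDiffeomorphAt.comp (hf := h1) (hg := h2)
  exact isLocalDiffeomorphAt_congr_nhds' h (Filter.Eventually.of_forall fun w =>
    show tA w = 4 * angA w + 0 by rw [tA, add_zero])

/-- `t_B` is a local diffeomorphism off `ptB`. [folklore] -/
theorem isLocalDiffeomorphAt_tB {z : sphere (0 : EuclideanSpace ℝ (Fin 2)) 1} (hz : z ≠ ptB) :
    IsLocalDiffeomorphAt (𝓡 1) 𝓘(ℝ, ℝ) ∞ tB z := by
  have h1 := angBPD.isLocalDiffeomorphAt _ _ _ (show z ∈ angBPD.source from hz)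
  have h2 := (affineDiffeo 4 (-4) (by norm_num)).isLocalDiffeomorph (angBPD z)
  have h := IsLocalDiffeomorphAt.comp (hf := h1) (hg := h2)
  exact isLocalDiffeomorphAt_congr_nhds' h (Filter.Eventually.of_forall fun w =>
    show tB w = 4 * angB w + -4 by rw [tB]; ring)

/-- `-t_B` is a local diffeomorphism off `ptB`. [folklore] -/
theorem isLocalDiffeomorphAt_neg_tB {z : sphere (0 : EuclideanSpace ℝ (Fin 2)) 1} (hz : z ≠ ptB) :
    IsLocalDiffeomorphAt (𝓡 1) 𝓘(ℝ, ℝ) ∞ (fun z => -tB z) z := by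
  have h1 := angBPD.isLocalDiffeomorphAt _ _ _ (show z ∈ angBPD.source from hz)
  have h2 := (affineDiffeo (-4) 4 (by norm_num)).isLocalDiffeomorph (angBPD z)
  have h := IsLocalDiffeomorphAt.comp (hf := h1) (hg := h2)
  exact isLocalDiffeomorphAt_congr_nhds' h (Filter.Eventually.of_forall fun w =>
    show -tB w = -4 * angB w + 4 by rw [tB]; ring)

/-! ### The coordinate maps from the torus side -/

/-- The coordinate map `((z₁, z₂), v) ↦ (z₁, f z₂, ν(v))` is a local diffeomorphism wherever the
loop coordinate `f` is. [folklore] -/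
theorem isLocalDiffeomorphAt_coord {f : sphere (0 : EuclideanSpace ℝ (Fin 2)) 1 → ℝ}
    {x : (sphere (0 : EuclideanSpace ℝ (Fin 2)) 1 × sphere (0 : EuclideanSpace ℝ (Fin 2)) 1) × EuclideanSpace ℝ (Fin 2)}
    (hf : IsLocalDiffeomorphAt (𝓡 1) 𝓘(ℝ, ℝ) ∞ f x.1.2) :
    IsLocalDiffeomorphAt (((𝓡 1).prod (𝓡 1)).prod 𝓘(ℝ, EuclideanSpace ℝ (Fin 2))) ((𝓡 1).prod 𝓘(ℝ, ℝ × ℂ)) ∞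
      (fun x : (sphere (0 : EuclideanSpace ℝ (Fin 2)) 1 × sphere (0 : EuclideanSpace ℝ (Fin 2)) 1) ×
        EuclideanSpace ℝ (Fin 2) => ((x.1.1, f x.1.2, nuOfV x.2) :
          sphere (0 : EuclideanSpace ℝ (Fin 2)) 1 × ℝ × ℂ)) x := by
  obtain ⟨⟨z₁, z₂⟩, v⟩ := x
  have h1 : IsLocalDiffeomorphAt (((𝓡 1).prod (𝓡 1)).prod 𝓘(ℝ, EuclideanSpace ℝ (Fin 2)))
      (((𝓡 1).prod 𝓘(ℝ, ℝ)).prod 𝓘(ℝ, ℂ)) ∞ (Prod.map (Prod.map id f) nuOfV) ((z₁, z₂), v) :=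
    IsLocalDiffeomorphAt.prodMap' (IsLocalDiffeomorphAt.prodMap'
      ((Diffeomorph.refl (𝓡 1) (sphere (0 : EuclideanSpace ℝ (Fin 2)) 1) ∞).isLocalDiffeomorph z₁) hf)
      (isLocalDiffeomorphAt_nuOfV v)
  have h2 := assocV.symm.isLocalDiffeomorph (Prod.map (Prod.map id f) nuOfV ((z₁, z₂), v))
  have h := IsLocalDiffeomorphAt.comp (hf := h1) (hg := h2)
  exact h

/-! ### The first torus: the pre-map on `T² × ℝ²` -/

open Classical in
/-- **The pre-map of the first torus** on `T² × ℝ²`: upper half by the half-torus map in the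
loop coordinate `t_B`, lower half by its mirror in `-t_B`. [folklore] -/
def T0pre (x : (sphere (0 : EuclideanSpace ℝ (Fin 2)) 1 × sphere (0 : EuclideanSpace ℝ (Fin 2)) 1) ×
    EuclideanSpace ℝ (Fin 2)) : sphere (0 : EuclideanSpace ℝ (Fin 3)) 1 × EuclideanSpace ℝ (Fin 2) :=
  if angA x.1.2 ≤ 1 / 2 then Nmap (x.1.1, tB x.1.2, nuOfV x.2)
  else mirrorM (Nmap (x.1.1, -tB x.1.2, nuOfV x.2))

/-- `angA` is continuous off `ptA`. [folklore] -/
theorem continuousOn_angA : ContinuousOn angA {z : sphere (0 : EuclideanSpace ℝ (Fin 2)) 1 | z ≠ ptA} :=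
  fun _ hz => (contMDiffAt_angA hz).continuousAt.continuousWithinAt

/-- The upper open half `{angA < 1/2}` is open. [folklore] -/
theorem isOpen_angA_lt : IsOpen {z : sphere (0 : EuclideanSpace ℝ (Fin 2)) 1 | angA z < 1 / 2} := by
  have h := continuousOn_angA.isOpen_inter_preimage isOpen_ne (isOpen_Iio (a := (1 / 2 : ℝ)))
  convert h using 1
  ext z
  simp only [mem_setOf_eq, mem_inter_iff, mem_preimage, mem_Iio, iff_and_self]
  intro hz h'
  rw [(angA_eq_one_iff z).2 h'] at hz; norm_num at hz

/-- The lower open half `{1/2 < angA} ∖ {ptA}` is open. [folklore] -/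
theorem isOpen_angA_gt : IsOpen {z : sphere (0 : EuclideanSpace ℝ (Fin 2)) 1 | z ≠ ptA ∧ 1 / 2 < angA z} :=
  continuousOn_angA.isOpen_inter_preimage isOpen_ne (isOpen_Ioi (a := (1 / 2 : ℝ)))

/-- **Local form 1**: on the upper open half, `T0pre = Nmap ∘ (z₁, t_B, ν)`. [folklore] -/
theorem T0pre_eventuallyEq_upper
    {x : (sphere (0 : EuclideanSpace ℝ (Fin 2)) 1 × sphere (0 : EuclideanSpace ℝ (Fin 2)) 1) × EuclideanSpace ℝ (Fin 2)}
    (hx : angA x.1.2 < 1 / 2) :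
    T0pre =ᶠ[𝓝 x] fun x => Nmap (x.1.1, tB x.1.2, nuOfV x.2) := by
  have ho : IsOpen {x : (sphere (0 : EuclideanSpace ℝ (Fin 2)) 1 × sphere (0 : EuclideanSpace ℝ (Fin 2)) 1) ×
      EuclideanSpace ℝ (Fin 2) | angA x.1.2 < 1 / 2} :=
    isOpen_angA_lt.preimage (continuous_snd.comp continuous_fst)
  filter_upwards [ho.mem_nhds hx] with y hy
  rw [T0pre, if_pos (le_of_lt hy)]

/-- **Local form 2**: on the lower open half, `T0pre = mirror ∘ Nmap ∘ (z₁, -t_B, ν)`. [folklore] -/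
theorem T0pre_eventuallyEq_lower
    {x : (sphere (0 : EuclideanSpace ℝ (Fin 2)) 1 × sphere (0 : EuclideanSpace ℝ (Fin 2)) 1) × EuclideanSpace ℝ (Fin 2)}
    (hx : 1 / 2 < angA x.1.2) (hA : x.1.2 ≠ ptA) :
    T0pre =ᶠ[𝓝 x] fun x => mirrorM (Nmap (x.1.1, -tB x.1.2, nuOfV x.2)) := by
  have ho : IsOpen {x : (sphere (0 : EuclideanSpace ℝ (Fin 2)) 1 × sphere (0 : EuclideanSpace ℝ (Fin 2)) 1) ×
      EuclideanSpace ℝ (Fin 2) | x.1.2 ≠ ptA ∧ 1 / 2 < angA x.1.2} :=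
    isOpen_angA_gt.preimage (continuous_snd.comp continuous_fst)
  filter_upwards [ho.mem_nhds ⟨hA, hx⟩] with y hy
  rw [T0pre, if_neg (not_le.2 hy.2)]

/-- **Local form 3**: near the top of the handle (`z₂` near `ptB`), `T0pre = TH ∘ (z₁, t_A, ν)`.
[folklore] -/
theorem T0pre_eventuallyEq_top
    {x : (sphere (0 : EuclideanSpace ℝ (Fin 2)) 1 × sphere (0 : EuclideanSpace ℝ (Fin 2)) 1) × EuclideanSpace ℝ (Fin 2)}
    (hx : tA x.1.2 ∈ Ioo (11 / 10 : ℝ) (29 / 10)) :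
    T0pre =ᶠ[𝓝 x] fun x => TH (x.1.1, tA x.1.2, nuOfV x.2) := by
  have hA0 : x.1.2 ≠ ptA := fun h => by
    rw [h, tA, (angA_eq_one_iff _).2 rfl] at hx; norm_num at hx
  have ho : IsOpen {y : (sphere (0 : EuclideanSpace ℝ (Fin 2)) 1 × sphere (0 : EuclideanSpace ℝ (Fin 2)) 1) ×
      EuclideanSpace ℝ (Fin 2) | y.1.2 ≠ ptA ∧ tA y.1.2 ∈ Ioo (11 / 10 : ℝ) (29 / 10)} := by
    have hc : ContinuousOn tA {z : sphere (0 : EuclideanSpace ℝ (Fin 2)) 1 | z ≠ ptA} :=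
      fun _ hz => (contMDiffAt_tA hz).continuousAt.continuousWithinAt
    exact (hc.isOpen_inter_preimage isOpen_ne isOpen_Ioo).preimage (continuous_snd.comp continuous_fst)
  filter_upwards [ho.mem_nhds ⟨hA0, hx⟩] with y hy
  obtain ⟨⟨z₁, z₂⟩, v⟩ := y
  obtain ⟨hA, h1, h2⟩ := hy
  simp only at hA h1 h2 ⊢
  have htsw : tSw < 11 / 10 := by norm_num [tSw]
  by_cases hle : angA z₂ ≤ 1 / 2
  · rw [T0pre, if_pos hle]
    have htB : tB z₂ = tA z₂ := by
      rcases hle.lt_or_eq with h | h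
      · exact tB_eq_tA_of_lt h
      · rw [(angA_eq_half_iff _).1 h]; simp
    simp only
    rw [htB, Nmap_of_le (by simp only; linarith)]
  · rw [T0pre, if_neg hle]
    push Not at hle
    have htB : tB z₂ = tA z₂ - 4 := tB_eq_tA_sub_of_gt hle hA
    simp only
    rw [htB, Nmap_of_le (by simp only; linarith), show -(tA z₂ - 4) = 4 - tA z₂ by ring,
      TH_four_sub h1.le h2.le, mirrorM_mirrorM]

/-- **Local form 4**: near the equator heights (`|t_B| < tSw`, in particular near `ptA`),
`T0pre = TV ∘ (z₁, t_B, ν)`. [folklore] -/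
theorem T0pre_eventuallyEq_equator
    {x : (sphere (0 : EuclideanSpace ℝ (Fin 2)) 1 × sphere (0 : EuclideanSpace ℝ (Fin 2)) 1) × EuclideanSpace ℝ (Fin 2)}
    (hx : |tB x.1.2| < tSw) :
    T0pre =ᶠ[𝓝 x] fun x => TV (x.1.1, tB x.1.2, nuOfV x.2) := by
  have hB0 : x.1.2 ≠ ptB := fun h => by
    rw [h, tB_ptB, tSw] at hx; norm_num [abs_of_pos] at hx
  have ho : IsOpen {y : (sphere (0 : EuclideanSpace ℝ (Fin 2)) 1 × sphere (0 : EuclideanSpace ℝ (Fin 2)) 1) ×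
      EuclideanSpace ℝ (Fin 2) | y.1.2 ≠ ptB ∧ |tB y.1.2| < tSw} := by
    have hc : ContinuousOn (fun z => |tB z|) {z : sphere (0 : EuclideanSpace ℝ (Fin 2)) 1 | z ≠ ptB} :=
      fun _ hz => (continuous_abs.continuousAt.comp (contMDiffAt_tB hz).continuousAt).continuousWithinAt
    exact (hc.isOpen_inter_preimage isOpen_ne (isOpen_Iio (a := tSw))).preimage (continuous_snd.comp continuous_fst)
  filter_upwards [ho.mem_nhds ⟨hB0, hx⟩] with y hy
  obtain ⟨⟨z₁, z₂⟩, v⟩ := y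
  obtain ⟨_, h1⟩ := hy
  simp only at h1 ⊢
  obtain ⟨h1a, h1b⟩ := abs_lt.1 h1
  by_cases hle : angA z₂ ≤ 1 / 2
  · rw [T0pre, if_pos hle]
    simp only
    rw [Nmap_of_lt (by simp only; exact h1b)]
  · rw [T0pre, if_neg hle]
    simp only
    rw [Nmap_of_lt (by simp only; linarith), TV_neg' (zoneV_of_abs_lt h1) (norm_nuOfV_lt v).le, mirrorM_mirrorM]

/-- The four local forms cover the torus: every `z₂` is in the upper open half, the lower open
half, near the top, or near the equator heights. [folklore] -/
theorem cover (z : sphere (0 : EuclideanSpace ℝ (Fin 2)) 1) :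
    angA z < 1 / 2 ∨ (1 / 2 < angA z ∧ z ≠ ptA) ∨ tA z ∈ Ioo (11 / 10 : ℝ) (29 / 10) ∨ |tB z| < tSw := by
  rcases lt_trichotomy (angA z) (1 / 2) with h | h | h
  · exact Or.inl h
  · right; right; left
    rw [tA, h]; norm_num
  · by_cases hA : z = ptA
    · right; right; right
      rw [hA, tB_ptA, abs_zero]; norm_num [tSw]
    · exact Or.inr (Or.inl ⟨h, hA⟩)

/-- On the upper half the loop coordinate is good for the half-torus map. [folklore] -/
theorem NGood_of_mem {t : ℝ} (ht : t ∈ Ioc (0 : ℝ) 2) {ν : ℂ} (hν : ‖ν‖ < nuMax)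
    (z : sphere (0 : EuclideanSpace ℝ (Fin 2)) 1) : NGood (z, t, ν) := by
  refine ⟨?_, hν⟩
  simp only
  by_cases h : t ^ 2 < 491 / 500
  · exact Or.inl h
  · right
    push Not at h
    refine ⟨?_, ?_⟩
    · rw [Real.sqrt_lt' ht.1]; nlinarith [ht.1]
    · have : Real.sqrt (49 / 50) < 1 := by rw [Real.sqrt_lt' (by norm_num)]; norm_num
      linarith [ht.2]

/-- **The pre-map of the first torus is a local diffeomorphism everywhere.** [folklore] -/
theorem isLocalDiffeomorph_T0pre :
    IsLocalDiffeomorph (((𝓡 1).prod (𝓡 1)).prod 𝓘(ℝ, EuclideanSpace ℝ (Fin 2)))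
      ((𝓡 2).prod 𝓘(ℝ, EuclideanSpace ℝ (Fin 2))) ∞ T0pre := by
  intro x
  have hν : ‖nuOfV x.2‖ < nuMax := norm_nuOfV_lt x.2
  rcases cover x.1.2 with h | ⟨h, hA⟩ | h | h
  · -- upper open half
    have hB : x.1.2 ≠ ptB := fun h' => by rw [(angA_eq_half_iff _).2 h'] at h; norm_num at h
    have h1 := isLocalDiffeomorphAt_coord (x := x) (isLocalDiffeomorphAt_tB hB)
    have hgood : NGood (x.1.1, tB x.1.2, nuOfV x.2) := by
      rw [tB_eq_tA_of_lt h]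
      exact NGood_of_mem ⟨(tA_mem _).1, by rw [tA]; linarith⟩ hν _
    have h2 := isLocalDiffeomorphAt_Nmap hgood
    exact isLocalDiffeomorphAt_congr_nhds' (IsLocalDiffeomorphAt.comp (hf := h1) (hg := h2))
      (T0pre_eventuallyEq_upper h)
  · -- lower open half
    have hB : x.1.2 ≠ ptB := fun h' => by rw [(angA_eq_half_iff _).2 h'] at h; norm_num at h
    have h1 := isLocalDiffeomorphAt_coord (x := x) (isLocalDiffeomorphAt_neg_tB hB)
    have hgood : NGood (x.1.1, -tB x.1.2, nuOfV x.2) := by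
      rw [tB_eq_tA_sub_of_gt h hA]
      have := angA_lt_one hA
      exact NGood_of_mem ⟨by rw [tA]; linarith [(angA_mem_Ioc x.1.2).2], by rw [tA]; linarith⟩ hν _
    have h2 := isLocalDiffeomorphAt_Nmap hgood
    have h3 := mirrorDiffeo.isLocalDiffeomorph (Nmap (x.1.1, -tB x.1.2, nuOfV x.2))
    have h12 := IsLocalDiffeomorphAt.comp (hf := h1) (hg := h2)
    have h123 := IsLocalDiffeomorphAt.comp (hf := h12) (hg := h3)
    exact isLocalDiffeomorphAt_congr_nhds' h123 (T0pre_eventuallyEq_lower h hA)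
  · -- near the top
    have hA : x.1.2 ≠ ptA := fun h' => by
      rw [h', tA, (angA_eq_one_iff _).2 rfl] at h; norm_num at h
    have h1 := isLocalDiffeomorphAt_coord (x := x) (isLocalDiffeomorphAt_tA hA)
    have hzone : zoneH (tA x.1.2) := by
      have : Real.sqrt (49 / 50) < 1 := by rw [Real.sqrt_lt' (by norm_num)]; norm_num
      exact ⟨by linarith [h.1], by linarith [h.2]⟩
    have h2 := isLocalDiffeomorphAt_TH (p := (x.1.1, tA x.1.2, nuOfV x.2)) hzone hν
    exact isLocalDiffeomorphAt_congr_nhds' (IsLocalDiffeomorphAt.comp (hf := h1) (hg := h2))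
      (T0pre_eventuallyEq_top h)
  · -- near the equator heights
    have hB : x.1.2 ≠ ptB := fun h' => by rw [h', tB_ptB, tSw] at h; norm_num [abs_of_pos] at h
    have h1 := isLocalDiffeomorphAt_coord (x := x) (isLocalDiffeomorphAt_tB hB)
    have h2 := isLocalDiffeomorphAt_TV (p := (x.1.1, tB x.1.2, nuOfV x.2))
      (xiV_mem_Ioo (zoneV_of_abs_lt h) hν.le) hν
    exact isLocalDiffeomorphAt_congr_nhds' (IsLocalDiffeomorphAt.comp (hf := h1) (hg := h2))
      (T0pre_eventuallyEq_equator h)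

/-- The pre-map is continuous. [folklore] -/
theorem continuous_T0pre : Continuous T0pre := isLocalDiffeomorph_T0pre.isLocalHomeomorph.continuous

/-! ### The core of the first torus -/

/-- The handle parameter of the switching height. [folklore] -/
def uSw : ℝ := loopU tSw

/-- `0 < uSw ≤ 1/500`, `tan (π uSw) = tSw² - 49/50`. [folklore] -/
theorem uSw_facts : 0 < uSw ∧ uSw ≤ 1 / 500 ∧ tan (π * uSw) = tSw ^ 2 - 49 / 50 := by
  have h1 : (19 / 20 : ℝ) ≤ tSw := by norm_num [tSw]
  have h2 : tSw ≤ 993 / 1000 := by norm_num [tSw]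
  refine ⟨?_, loopU_le_of_le h1 h2, tan_pi_mul_loopU h1 (by linarith)⟩
  rw [uSw, ← loopU_sqrt]
  exact strictMono_loopU sqrt_lt_tSw

/-- **The handle radius is at least `tSw²` between the switching parameters.** [folklore] -/
theorem tSw_sq_le_rad {s a : ℝ} (hs : s ∈ Icc uSw (1 - uSw)) (ha : |a| ≤ 3 / 10) : tSw ^ 2 ≤ rad s a := by
  obtain ⟨hu0, hu1, htan⟩ := uSw_facts
  have hπ := pi_pos
  -- the north end
  have north : ∀ s', s' ∈ Icc uSw (1 / 10) → tSw ^ 2 ≤ rad s' a := by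
    intro s' hs'
    rw [rad_eq_of_le (by linarith [hs'.1]) hs'.2 ha]
    have hmono := Real.strictMonoOn_tan.monotoneOn
      (show π * uSw ∈ Ioo (-(π / 2)) (π / 2) from ⟨by nlinarith, by nlinarith⟩)
      (show π * s' ∈ Ioo (-(π / 2)) (π / 2) from ⟨by nlinarith [hs'.1], by nlinarith [hs'.2]⟩)
      (by nlinarith [hs'.1])
    linarith
  rcases le_or_gt s (1 / 10) with h | h
  · exact north s ⟨hs.1, h⟩
  rcases le_or_gt (9 / 10) s with h' | h'
  · rw [← rad_one_sub]
    exact north (1 - s) ⟨by linarith [hs.2], by linarith⟩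
  · have ha1 : -1 < a := by linarith [(abs_le.1 ha).1]
    have := HandlePlanar.bentStrip_snd_ge ⟨h.le, h'.le⟩ ha
    rw [rad]
    norm_num [tSw]
    linarith

/-- `0 < t_B z ↔ angA z ≤ 1/2` (the upper closed half in the two loop coordinates). [folklore] -/
theorem tB_pos_iff (z : sphere (0 : EuclideanSpace ℝ (Fin 2)) 1) : 0 < tB z ↔ angA z ≤ 1 / 2 := by
  by_cases hA : z = ptA
  · rw [hA, tB_ptA, (angA_eq_one_iff _).2 rfl]; norm_num
  by_cases hB : z = ptB
  · rw [hB, tB_ptB, (angA_eq_half_iff _).2 rfl]; norm_num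
  rcases angB_eq_of_ne hA hB with ⟨h1, h2⟩ | ⟨h1, h2⟩
  · rw [tB, h2]
    constructor
    · intro; exact h1.le
    · intro; linarith [(angA_mem_Ioc z).1]
  · rw [tB, h2]
    have := (angA_mem_Ioc z).2
    constructor
    · intro h; linarith
    · intro h; linarith

/-- **Core value, graph type**: for `|t_B| < tSw`, `T0pre ((z₁, z₂), 0) = TV (z₁, t_B, 0)`. [folklore] -/
theorem T0pre_core_V {z₁ z₂ : sphere (0 : EuclideanSpace ℝ (Fin 2)) 1} (h : |tB z₂| < tSw) :
    T0pre ((z₁, z₂), 0) = TV (z₁, tB z₂, 0) := by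
  have := (T0pre_eventuallyEq_equator (x := ((z₁, z₂), (0 : EuclideanSpace ℝ (Fin 2)))) h).self_of_nhds
  simpa using this

/-- **Core value, north handle type**: for `tSw ≤ t_B`, `T0pre ((z₁, z₂), 0) = h (loopU t_B, toC z₁, 0)`.
[folklore] -/
theorem T0pre_core_HN {z₁ z₂ : sphere (0 : EuclideanSpace ℝ (Fin 2)) 1} (h : tSw ≤ tB z₂) :
    T0pre ((z₁, z₂), 0) = handleMap (loopU (tB z₂), toC (z₁ : EuclideanSpace ℝ (Fin 2)), 0) := by
  have hpos : 0 < tB z₂ := lt_of_lt_of_le (by norm_num [tSw]) h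
  rw [T0pre, if_pos ((tB_pos_iff z₂).1 hpos)]
  simp only [nuOfV_zero]
  rw [Nmap_of_le (by exact h), TH_zero]

/-- **Core value, south handle type**: for `t_B ≤ -tSw`,
`T0pre ((z₁, z₂), 0) = h (1 - loopU (-t_B), toC z₁, 0)`. [folklore] -/
theorem T0pre_core_HS {z₁ z₂ : sphere (0 : EuclideanSpace ℝ (Fin 2)) 1} (h : tB z₂ ≤ -tSw) :
    T0pre ((z₁, z₂), 0) = handleMap (1 - loopU (-tB z₂), toC (z₁ : EuclideanSpace ℝ (Fin 2)), 0) := by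
  have hneg : ¬0 < tB z₂ := by
    intro h'
    have : (0 : ℝ) < tSw := by norm_num [tSw]
    linarith
  rw [T0pre, if_neg (by rwa [← tB_pos_iff])]
  simp only [nuOfV_zero]
  rw [Nmap_of_le (by simp only; linarith), TH_zero, handleMap_one_sub]
  rfl

/-- The plane coordinate of a graph-type core point has norm `< tSw²`. [folklore] -/
theorem norm_core_V_lt {z₁ : sphere (0 : EuclideanSpace ℝ (Fin 2)) 1} {t : ℝ} (h : |t| < tSw) :
    ‖(TV (z₁, t, 0)).2‖ < tSw ^ 2 := by
  rw [TV_zero]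
  simp only
  rw [IwasePolar.norm_toE, Complex.norm_real, Real.norm_of_nonneg (IwasePolar.gprof_nonneg _)]
  have h1 := IwasePolar.gprof_le (x := 1 - t ^ 2) (by nlinarith)
  have h2 : t ^ 2 < tSw ^ 2 := by
    have := abs_lt.1 h; have : (0:ℝ) < tSw := by norm_num [tSw]
    nlinarith
  linarith

/-- The plane coordinate of a handle-type core point has norm `≥ tSw²`. [folklore] -/
theorem tSw_sq_le_norm_core_H {z₁ : sphere (0 : EuclideanSpace ℝ (Fin 2)) 1} {u : ℝ} (hu : u ∈ Icc uSw (1 - uSw)) :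
    tSw ^ 2 ≤ ‖(handleMap (u, toC (z₁ : EuclideanSpace ℝ (Fin 2)), 0)).2‖ := by
  obtain ⟨hu0, hu1, -⟩ := uSw_facts
  have hζ : ‖toC (z₁ : EuclideanSpace ℝ (Fin 2))‖ ≤ 5 / 2 := by rw [norm_toC_sphere]; norm_num
  rw [norm_handleMap_snd ⟨by linarith [hu.1], by linarith [hu.2]⟩ hζ]
  exact tSw_sq_le_rad hu (abs_aOf_le u hζ)

/-- `loopU 2 = 1/2`. [folklore] -/
theorem loopU_two : loopU 2 = 1 / 2 := by rw [loopU_eq_sigM (by norm_num) (by norm_num), sigM]; norm_num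

/-- The handle parameter of a north handle-type core point lies in `[uSw, 1/2]`. [folklore] -/
theorem loopU_mem_of_tB {t : ℝ} (h1 : tSw ≤ t) (h2 : t ≤ 2) : loopU t ∈ Icc uSw (1 / 2) :=
  ⟨strictMono_loopU.monotone h1, loopU_two ▸ strictMono_loopU.monotone h2⟩

/-- `toC` is injective on the circle. [folklore] -/
theorem toC_sphere_injective : Injective fun z : sphere (0 : EuclideanSpace ℝ (Fin 2)) 1 =>
    toC (z : EuclideanSpace ℝ (Fin 2)) := fun a b h => by
  rw [← circleOf_toC a, ← circleOf_toC b]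
  exact congrArg _ h

/-- `t_B` is injective. [folklore] -/
theorem tB_injective : Injective tB := fun a b h => by
  have h' : angB a = angB b := by unfold tB at h; linarith
  rw [← circlePt_angB a, ← circlePt_angB b, h']

/-- The box parameters of handle-type core points. [folklore] -/
theorem core_param_mem {u : ℝ} (hu : u ∈ Icc uSw (1 - uSw)) (z₁ : sphere (0 : EuclideanSpace ℝ (Fin 2)) 1) :
    ((u, toC (z₁ : EuclideanSpace ℝ (Fin 2)), (0 : ℝ)) : ℝ × ℂ × ℝ) ∈
      {u : ℝ × ℂ × ℝ | u.1 ∈ Icc (0 : ℝ) 1 ∧ ‖u.2.1‖ ≤ 5 / 2 ∧ u.2.2 ∈ Ioc (-π) π} := by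
  obtain ⟨hu0, hu1, -⟩ := uSw_facts
  exact ⟨⟨by linarith [hu.1], by linarith [hu.2]⟩, by rw [norm_toC_sphere]; norm_num,
    ⟨by linarith [pi_pos], pi_pos.le⟩⟩

/-- **The core of the first torus is injective.** Graph-type and handle-type core points are
separated by `‖w‖ ≶ tSw²`; graph-type points are recovered from height and direction, handle-type
points from the injectivity of the handle chart, north and south halves having parameters
`u ≤ 1/2 < u'`. [folklore] -/
theorem T0pre_core_injective :
    Injective fun x : sphere (0 : EuclideanSpace ℝ (Fin 2)) 1 × sphere (0 : EuclideanSpace ℝ (Fin 2)) 1 =>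
      T0pre (x, 0) := by
  obtain ⟨hu0, hu1, -⟩ := uSw_facts
  rintro ⟨z₁, z₂⟩ ⟨z₁', z₂'⟩ h
  simp only at h
  have key : ∀ {a b : sphere (0 : EuclideanSpace ℝ (Fin 2)) 1 × sphere (0 : EuclideanSpace ℝ (Fin 2)) 1},
      T0pre (a, 0) = T0pre (b, 0) → |tB a.2| < tSw → |tB b.2| < tSw := by
    rintro ⟨a₁, a₂⟩ ⟨b₁, b₂⟩ hab ha
    by_contra hb
    push Not at hb
    have hlt := norm_core_V_lt (z₁ := a₁) ha
    rw [← T0pre_core_V ha, hab] at hlt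
    rcases le_abs'.1 hb with hb' | hb'
    · rw [T0pre_core_HS hb'] at hlt
      have hmem : 1 - loopU (-tB b₂) ∈ Icc uSw (1 - uSw) := by
        have := loopU_mem_of_tB (t := -tB b₂) (by linarith) (by linarith [(tB_mem b₂).1])
        exact ⟨by linarith [this.2], by linarith [this.1]⟩
      linarith [tSw_sq_le_norm_core_H (z₁ := b₁) hmem]
    · rw [T0pre_core_HN hb'] at hlt
      have hmem : loopU (tB b₂) ∈ Icc uSw (1 - uSw) := by
        have := loopU_mem_of_tB hb' (tB_mem b₂).2
        exact ⟨this.1, by linarith [this.2]⟩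
      linarith [tSw_sq_le_norm_core_H (z₁ := b₁) hmem]
  by_cases hV : |tB z₂| < tSw
  · -- both graph type
    have hV' : |tB z₂'| < tSw := key (a := (z₁, z₂)) (b := (z₁', z₂')) h hV
    rw [T0pre_core_V hV, T0pre_core_V hV', TV_zero, TV_zero, Prod.mk.injEq] at h
    have hI : tB z₂ ∈ Icc (-1 : ℝ) 1 := by
      have := abs_lt.1 hV; norm_num [tSw] at this; exact ⟨by linarith, by linarith⟩
    have hI' : tB z₂' ∈ Icc (-1 : ℝ) 1 := by
      have := abs_lt.1 hV'; norm_num [tSw] at this; exact ⟨by linarith, by linarith⟩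
    have ht : tB z₂ = tB z₂' := by
      have := congrArg (fun P : sphere (0 : EuclideanSpace ℝ (Fin 3)) 1 => (P : EuclideanSpace ℝ (Fin 3)) 2) h.1
      simpa [cylPt_apply_two _ hI, cylPt_apply_two _ hI'] using this
    have hz₂ : z₂ = z₂' := tB_injective ht
    have hIoo : tB z₂ ∈ Ioo (-1 : ℝ) 1 := by
      have := abs_lt.1 hV; norm_num [tSw] at this; exact ⟨by linarith, by linarith⟩
    have hz₁ : z₁ = z₁' := by
      have := congrArg cylInv h.1
      rw [← ht, cylInv_cylPt _ hIoo, cylInv_cylPt _ hIoo, Prod.mk.injEq] at this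
      exact this.1
    rw [hz₁, hz₂]
  · -- both handle type
    have hV' : ¬|tB z₂'| < tSw := fun h' => hV (key (a := (z₁', z₂')) (b := (z₁, z₂)) h.symm h')
    push Not at hV hV'
    -- parameters
    have memN : ∀ {b : sphere (0 : EuclideanSpace ℝ (Fin 2)) 1}, tSw ≤ tB b → loopU (tB b) ∈ Icc uSw (1 - uSw) ∧
        loopU (tB b) ≤ 1 / 2 := fun hb => by
      have := loopU_mem_of_tB hb (tB_mem _).2
      exact ⟨⟨this.1, by linarith [this.2]⟩, this.2⟩
    have memS : ∀ {b : sphere (0 : EuclideanSpace ℝ (Fin 2)) 1}, tB b ≤ -tSw → 1 - loopU (-tB b) ∈ Icc uSw (1 - uSw) ∧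
        1 / 2 < 1 - loopU (-tB b) := fun {b} hb => by
      have h2 : -tB b < 2 := by linarith [(tB_mem b).1]
      have := loopU_mem_of_tB (t := -tB b) (by linarith) h2.le
      have hlt : loopU (-tB b) < 1 / 2 := loopU_two ▸ strictMono_loopU h2
      exact ⟨⟨by linarith, by linarith [this.1]⟩, by linarith⟩
    rcases le_abs'.1 hV with h1 | h1 <;> rcases le_abs'.1 hV' with h2 | h2
    · -- south / south
      rw [T0pre_core_HS h1, T0pre_core_HS h2] at h
      have := handleMap_injOn (core_param_mem (memS h1).1 z₁) (core_param_mem (memS h2).1 z₁') h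
      simp only [Prod.mk.injEq] at this
      have hu : loopU (-tB z₂) = loopU (-tB z₂') := by linarith [this.1]
      have ht : tB z₂ = tB z₂' := by have := strictMono_loopU.injective hu; linarith
      rw [tB_injective ht, toC_sphere_injective this.2.1]
    · -- south / north : impossible
      rw [T0pre_core_HS h1, T0pre_core_HN h2] at h
      have := handleMap_injOn (core_param_mem (memS h1).1 z₁) (core_param_mem (memN h2).1 z₁') h
      simp only [Prod.mk.injEq] at this
      linarith [(memS h1).2, (memN h2).2, this.1]
    · -- north / south : impossible
      rw [T0pre_core_HN h1, T0pre_core_HS h2] at h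
      have := handleMap_injOn (core_param_mem (memN h1).1 z₁) (core_param_mem (memS h2).1 z₁') h
      simp only [Prod.mk.injEq] at this
      linarith [(memN h1).2, (memS h2).2, this.1]
    · -- north / north
      rw [T0pre_core_HN h1, T0pre_core_HN h2] at h
      have := handleMap_injOn (core_param_mem (memN h1).1 z₁) (core_param_mem (memN h2).1 z₁') h
      simp only [Prod.mk.injEq] at this
      rw [tB_injective (strictMono_loopU.injective this.1), toC_sphere_injective this.2.1]

/-- **A uniform tube on which the pre-map is injective.** [folklore] -/
theorem exists_injOn_T0pre : ∃ ε > 0, InjOn T0pre (univ ×ˢ ball (0 : EuclideanSpace ℝ (Fin 2)) ε) := by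
  refine exists_injOn_prod_ball continuous_T0pre T0pre_core_injective fun x => ?_
  obtain ⟨Φ, hx, heq⟩ := isLocalDiffeomorph_T0pre (x, 0)
  refine ⟨Φ.source, Φ.open_source.mem_nhds hx, fun a ha b hb hab => ?_⟩
  exact Φ.injOn ha hb (by rw [← heq ha, ← heq hb]; exact hab)

/-! ### Squeezing the fibre: smooth embeddings from injective local diffeomorphisms -/

/-- `univBall 0 ε v = ε • univUnitBall v`. [folklore] -/
theorem univBall_zero_apply {ε : ℝ} (hε : 0 < ε) (v : EuclideanSpace ℝ (Fin 2)) :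
    OpenPartialHomeomorph.univBall (0 : EuclideanSpace ℝ (Fin 2)) ε v = ε • OpenPartialHomeomorph.univUnitBall v := by
  rw [OpenPartialHomeomorph.univBall, dif_pos hε]
  simp [OpenPartialHomeomorph.unitBallBall, OpenPartialHomeomorph.trans']

/-- The squeezed fibre is a positive multiple of the fibre. [folklore] -/
theorem univBall_zero_eq_smul {ε : ℝ} (hε : 0 < ε) (v : EuclideanSpace ℝ (Fin 2)) :
    ∃ c : ℝ, 0 < c ∧ OpenPartialHomeomorph.univBall (0 : EuclideanSpace ℝ (Fin 2)) ε v = c • v := by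
  refine ⟨ε * (Real.sqrt (1 + ‖v‖ ^ 2))⁻¹, mul_pos hε (inv_pos.2 (Real.sqrt_pos.2 (by positivity))), ?_⟩
  rw [univBall_zero_apply hε, OpenPartialHomeomorph.univUnitBall_apply, smul_smul]

/-- The unit vector of a positive multiple. [folklore] -/
theorem unitVector₀_smul_of_pos {c : ℝ} (hc : 0 < c) (v : EuclideanSpace ℝ (Fin 2)) :
    unitVector₀ (c • v) = unitVector₀ v := by
  by_cases hv : v = 0
  · rw [hv, smul_zero]
  · have hcv : c • v ≠ 0 := smul_ne_zero hc.ne' hv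
    apply Subtype.ext
    rw [unitVector₀_of_ne_zero hcv, unitVector₀_of_ne_zero hv, coe_unitVector, coe_unitVector, norm_smul,
      Real.norm_of_nonneg hc.le, smul_smul]
    congr 1
    field_simp

/-- The squeezed fibre has the same unit vector. [folklore] -/
theorem unitVector₀_univBall {ε : ℝ} (hε : 0 < ε) (v : EuclideanSpace ℝ (Fin 2)) :
    unitVector₀ (OpenPartialHomeomorph.univBall (0 : EuclideanSpace ℝ (Fin 2)) ε v) = unitVector₀ v := by
  obtain ⟨c, hc, h⟩ := univBall_zero_eq_smul hε v
  rw [h, unitVector₀_smul_of_pos hc]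

/-- The squeezed fibre vanishes iff the fibre does. [folklore] -/
theorem univBall_zero_eq_zero_iff {ε : ℝ} (hε : 0 < ε) {v : EuclideanSpace ℝ (Fin 2)} :
    OpenPartialHomeomorph.univBall (0 : EuclideanSpace ℝ (Fin 2)) ε v = 0 ↔ v = 0 := by
  obtain ⟨c, hc, h⟩ := univBall_zero_eq_smul hε v
  rw [h, smul_eq_zero, or_iff_right hc.ne']

/-- **The squeeze of a pre-map**: `T (x, v) = F (x, univBall 0 ε v)`. [folklore] -/
def sqz (F : (sphere (0 : EuclideanSpace ℝ (Fin 2)) 1 × sphere (0 : EuclideanSpace ℝ (Fin 2)) 1) × EuclideanSpace ℝ (Fin 2) →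
      sphere (0 : EuclideanSpace ℝ (Fin 3)) 1 × EuclideanSpace ℝ (Fin 2)) (ε : ℝ)
    (x : (sphere (0 : EuclideanSpace ℝ (Fin 2)) 1 × sphere (0 : EuclideanSpace ℝ (Fin 2)) 1) × EuclideanSpace ℝ (Fin 2)) :
    sphere (0 : EuclideanSpace ℝ (Fin 3)) 1 × EuclideanSpace ℝ (Fin 2) :=
  F (x.1, OpenPartialHomeomorph.univBall (0 : EuclideanSpace ℝ (Fin 2)) ε x.2)

/-- The squeeze on the zero section. [folklore] -/
@[simp] theorem sqz_zero (F : (sphere (0 : EuclideanSpace ℝ (Fin 2)) 1 × sphere (0 : EuclideanSpace ℝ (Fin 2)) 1) ×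
      EuclideanSpace ℝ (Fin 2) → sphere (0 : EuclideanSpace ℝ (Fin 3)) 1 × EuclideanSpace ℝ (Fin 2)) (ε : ℝ)
    (x : sphere (0 : EuclideanSpace ℝ (Fin 2)) 1 × sphere (0 : EuclideanSpace ℝ (Fin 2)) 1) :
    sqz F ε (x, 0) = F (x, 0) := by
  simp [sqz]

/-- A linear identification of the model spaces `(ℝ¹ × ℝ¹) × ℝ² ≅ ℝ² × ℝ²`. [folklore] -/
def modelEquiv : ((EuclideanSpace ℝ (Fin 1) × EuclideanSpace ℝ (Fin 1)) × EuclideanSpace ℝ (Fin 2)) ≃L[ℝ]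
    (EuclideanSpace ℝ (Fin 2) × EuclideanSpace ℝ (Fin 2)) :=
  ContinuousLinearEquiv.ofFinrankEq (by simp [Module.finrank_prod])

/-- **An everywhere-local-diffeomorphic pre-map which is injective on a uniform tube squeezes to a
smooth embedding of `T² × ℝ²`.** [folklore] -/
theorem isSmoothEmbedding_sqz
    {F : (sphere (0 : EuclideanSpace ℝ (Fin 2)) 1 × sphere (0 : EuclideanSpace ℝ (Fin 2)) 1) × EuclideanSpace ℝ (Fin 2) →
      sphere (0 : EuclideanSpace ℝ (Fin 3)) 1 × EuclideanSpace ℝ (Fin 2)}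
    (hF : IsLocalDiffeomorph (((𝓡 1).prod (𝓡 1)).prod 𝓘(ℝ, EuclideanSpace ℝ (Fin 2)))
      ((𝓡 2).prod 𝓘(ℝ, EuclideanSpace ℝ (Fin 2))) ∞ F)
    {ε : ℝ} (hε : 0 < ε) (hinj : InjOn F (univ ×ˢ ball (0 : EuclideanSpace ℝ (Fin 2)) ε)) :
    Manifold.IsSmoothEmbedding (((𝓡 1).prod (𝓡 1)).prod 𝓘(ℝ, EuclideanSpace ℝ (Fin 2)))
      ((𝓡 2).prod 𝓘(ℝ, EuclideanSpace ℝ (Fin 2))) ∞ (sqz F ε) := by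
  refine isSmoothEmbedding_of_isLocalDiffeomorph (fun x => ?_) (fun x y hxy => ?_) modelEquiv
  · exact IsLocalDiffeomorphAt.comp (hf := isLocalDiffeomorphAt_prodUnivBall hε x) (hg := hF _)
  · have hx : (x.1, OpenPartialHomeomorph.univBall (0 : EuclideanSpace ℝ (Fin 2)) ε x.2) ∈
        univ ×ˢ ball (0 : EuclideanSpace ℝ (Fin 2)) ε := ⟨mem_univ _, univBall_mem_ball hε _⟩
    have hy : (y.1, OpenPartialHomeomorph.univBall (0 : EuclideanSpace ℝ (Fin 2)) ε y.2) ∈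
        univ ×ˢ ball (0 : EuclideanSpace ℝ (Fin 2)) ε := ⟨mem_univ _, univBall_mem_ball hε _⟩
    have h := hinj hx hy hxy
    rw [Prod.mk.injEq] at h
    exact Prod.ext h.1 (univBall_injective ε h.2)

/-- The squeeze is injective on the whole of `T² × ℝ²`. [folklore] -/
theorem sqz_injective
    {F : (sphere (0 : EuclideanSpace ℝ (Fin 2)) 1 × sphere (0 : EuclideanSpace ℝ (Fin 2)) 1) × EuclideanSpace ℝ (Fin 2) →
      sphere (0 : EuclideanSpace ℝ (Fin 3)) 1 × EuclideanSpace ℝ (Fin 2)}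
    (hF : IsLocalDiffeomorph (((𝓡 1).prod (𝓡 1)).prod 𝓘(ℝ, EuclideanSpace ℝ (Fin 2)))
      ((𝓡 2).prod 𝓘(ℝ, EuclideanSpace ℝ (Fin 2))) ∞ F)
    {ε : ℝ} (hε : 0 < ε) (hinj : InjOn F (univ ×ˢ ball (0 : EuclideanSpace ℝ (Fin 2)) ε)) :
    Injective (sqz F ε) :=
  (isSmoothEmbedding_sqz hF hε hinj).2.injective

/-! ### The range of the core is the singular torus `Σ₀` -/

/-- **The north handle core point in closed form**: for `√(49/50) < t ≤ 0.993`,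
`TH (z, t, 0) = (cylPt z t, toE (t²))`. [folklore] -/
theorem TH_zero_eq {z : sphere (0 : EuclideanSpace ℝ (Fin 2)) 1} {t : ℝ} (h1 : Real.sqrt (49 / 50) < t)
    (h2 : t ≤ 993 / 1000) : TH (z, t, 0) = (cylPt z t, IwasePolar.toE ↑(t ^ 2)) := by
  have hs : (19 / 20 : ℝ) ≤ Real.sqrt (49 / 50) := by
    rw [Real.le_sqrt (by norm_num) (by norm_num)]; norm_num
  have ht1 : 19 / 20 ≤ t := by linarith
  have ht0 : 0 < t := by linarith
  have hsq : 49 / 50 < t ^ 2 := by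
    have := Real.sq_sqrt (show (0 : ℝ) ≤ 49 / 50 by norm_num)
    nlinarith [Real.sqrt_nonneg (49 / 50)]
  set u := loopU t with hu
  have hu0 : 0 ≤ u := by rw [hu, loopU_eq_sigN ht1 (by linarith)]; exact sigN_nonneg hsq.le
  have hu1 : u ≤ 1 / 500 := loopU_le_of_le ht1 h2
  have htan : tan (π * u) = t ^ 2 - 49 / 50 := tan_pi_mul_loopU ht1 (by linarith)
  have hK : Kfun u = 1 - t ^ 2 := by rw [Kfun_eq_of_le hu0 hu1, htan]; ring
  have hk : kfun u = Real.sqrt (1 - t ^ 2) := by rw [kfun, hK]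
  have htI : t ∈ Icc (-1 : ℝ) 1 := ⟨by linarith, by linarith⟩
  have hζ : ‖toC (z : EuclideanSpace ℝ (Fin 2))‖ ≤ 5 / 2 := by rw [norm_toC_sphere]; norm_num
  rw [TH_zero, ← hu]
  refine Prod.ext ?_ ?_
  · apply Subtype.ext
    rw [handleMap_coe_fst_of_le hu0 (by linarith) hζ, coe_cylPt z htI]
    have h3 : Real.sqrt (1 - kfun u ^ 2 * ‖toC (z : EuclideanSpace ℝ (Fin 2))‖ ^ 2) = t := by
      rw [norm_toC_sphere, kfun_sq, hK]; simp [Real.sqrt_sq ht0.le]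
    ext i
    fin_cases i
    · simp [toC, hk, mul_comm]
    · simp [toC, hk, mul_comm]
    · simpa using h3
  · simp only
    rw [handleMap_snd_of_le hu0 (by linarith) hζ, htan, wOf]
    norm_num

/-- Graph-type core points lie on the polar torus `Σ_N`. [folklore] -/
theorem TV_zero_mem_SigmaN (z : sphere (0 : EuclideanSpace ℝ (Fin 2)) 1) {t : ℝ} (h : |t| < tSw) :
    TV (z, t, 0) ∈ SigmaN := by
  have hlt := norm_core_V_lt (z₁ := z) h
  have htI : t ∈ Icc (-1 : ℝ) 1 := by
    have := abs_lt.1 h; norm_num [tSw] at this; exact ⟨by linarith, by linarith⟩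
  refine ⟨by norm_num [tSw] at hlt ⊢; linarith, ?_⟩
  rw [TV_zero]
  simp only
  rw [IwasePolar.toC_toE, xsq_cylPt z htI]

/-- Handle-type core points lie on the handle torus `Σ_H`. [folklore] -/
theorem handleMap_core_mem_SigmaH {u : ℝ} (hu : u ∈ Ioo (0 : ℝ) 1) (z : sphere (0 : EuclideanSpace ℝ (Fin 2)) 1) :
    handleMap (u, toC (z : EuclideanSpace ℝ (Fin 2)), 0) ∈ SigmaH :=
  ⟨(u, toC (z : EuclideanSpace ℝ (Fin 2)), 0), ⟨⟨hu, by rw [norm_toC_sphere]; norm_num, by norm_num⟩,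
    ⟨norm_toC_sphere z, rfl⟩⟩, rfl⟩

/-- **The core of the first torus lies on `Σ₀`.** [folklore] -/
theorem T0pre_core_mem (x : sphere (0 : EuclideanSpace ℝ (Fin 2)) 1 × sphere (0 : EuclideanSpace ℝ (Fin 2)) 1) :
    T0pre (x, 0) ∈ Sigma0 := by
  obtain ⟨z₁, z₂⟩ := x
  obtain ⟨hu0, hu1, -⟩ := uSw_facts
  by_cases hV : |tB z₂| < tSw
  · rw [T0pre_core_V hV]; exact Or.inl (TV_zero_mem_SigmaN z₁ hV)
  · push Not at hV
    rcases le_abs'.1 hV with h | h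
    · rw [T0pre_core_HS h]
      refine Or.inr (handleMap_core_mem_SigmaH ⟨?_, ?_⟩ z₁)
      · have := (loopU_mem_of_tB (t := -tB z₂) (by linarith) (by linarith [(tB_mem z₂).1])).2; linarith
      · have := (loopU_mem_of_tB (t := -tB z₂) (by linarith) (by linarith [(tB_mem z₂).1])).1; linarith
    · rw [T0pre_core_HN h]
      refine Or.inr (handleMap_core_mem_SigmaH ⟨?_, ?_⟩ z₁)
      · have := (loopU_mem_of_tB h (tB_mem z₂).2).1; linarith
      · have := (loopU_mem_of_tB h (tB_mem z₂).2).2; linarith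

/-- The circle point with prescribed loop coordinate `t ∈ (-2, 2)`. [folklore] -/
def zOfT (t : ℝ) : sphere (0 : EuclideanSpace ℝ (Fin 2)) 1 := circlePt (t / 4 + 1)

/-- `t_B (zOfT t) = t` for `t ∈ (-2, 2)`. [folklore] -/
theorem tB_zOfT {t : ℝ} (ht : t ∈ Ioo (-2 : ℝ) 2) : tB (zOfT t) = t := by
  rw [tB, zOfT, angB_circlePt ⟨by linarith [ht.1], by linarith [ht.2]⟩]; ring

/-- `x(P) = 1 - x₂²` on the sphere. [folklore] -/
theorem xsq_eq_one_sub (P : sphere (0 : EuclideanSpace ℝ (Fin 3)) 1) :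
    IwasePolar.xsq P = 1 - (P : EuclideanSpace ℝ (Fin 3)) 2 ^ 2 := by
  rw [IwasePolar.xsq_eq]; linear_combination sphere_coord_sq_sum P

/-- **Points of the polar torus are core points.** [folklore] -/
theorem mem_range_of_mem_SigmaN {q : sphere (0 : EuclideanSpace ℝ (Fin 3)) 1 × EuclideanSpace ℝ (Fin 2)}
    (hq : q ∈ SigmaN) : ∃ x, T0pre (x, 0) = q := by
  obtain ⟨P, w⟩ := q
  obtain ⟨hw, hg⟩ := hq
  simp only at hw hg
  set ξ := (P : EuclideanSpace ℝ (Fin 3)) 2 with hξ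
  have hx : IwasePolar.xsq P = 1 - ξ ^ 2 := xsq_eq_one_sub P
  have habs : |ξ| ≤ 1 := by
    have h := sphere_coord_sq_sum P
    rw [abs_le]; constructor <;> nlinarith [sq_nonneg ((P : EuclideanSpace ℝ (Fin 3)) 0), sq_nonneg ((P : EuclideanSpace ℝ (Fin 3)) 1)]
  have hwE : w = IwasePolar.toE (toC w) := (IwasePolar.toE_toC w).symm
  -- the height is below `√0.985 < 0.993`
  have hξlt : |ξ| < 1 := by
    by_contra hcon
    push Not at hcon
    have h1 : ξ ^ 2 = 1 := by nlinarith [abs_le.1 habs, sq_abs ξ]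
    rw [hx, h1, sub_self, IwasePolar.gprof_of_le (by norm_num)] at hg
    -- then `toC w = 1`, contradicting `‖w‖ < 0.985`
    have : ‖w‖ = 1 := by rw [← norm_toC, hg]; simp
    linarith
  by_cases hV : |ξ| < tSw
  · refine ⟨((cylInv P).1, zOfT ξ), ?_⟩
    have htB : tB (zOfT ξ) = ξ := tB_zOfT ⟨by linarith [(abs_lt.1 hV).1, show tSw < 2 by norm_num [tSw]],
      by linarith [(abs_lt.1 hV).2, show tSw < 2 by norm_num [tSw]]⟩
    rw [T0pre_core_V (by rwa [htB]), htB, TV_zero]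
    refine Prod.ext ?_ ?_
    · exact cylPt_cylInv hξlt
    · simp only; rw [hwE, hg, hx]
  · push Not at hV
    have hx10 : IwasePolar.xsq P ≤ 1 / 10 := by rw [hx]; norm_num [tSw] at hV; nlinarith [abs_le.1 habs, sq_abs ξ]
    have hgv : IwasePolar.gprof (IwasePolar.xsq P) = ξ ^ 2 := by rw [IwasePolar.gprof_of_le hx10, hx]; ring
    have hnorm : ‖w‖ = ξ ^ 2 := by
      rw [← norm_toC, hg, hgv, Complex.norm_real, Real.norm_of_nonneg (sq_nonneg _)]
    have hξ2 : |ξ| ≤ 993 / 1000 := by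
      rw [← sq_abs] at hnorm; nlinarith [abs_nonneg ξ]
    have htSw2 : (0 : ℝ) < tSw ∧ tSw < 2 := by norm_num [tSw]
    rcases le_or_gt 0 ξ with hpos | hneg
    · -- north handle type
      rw [abs_of_nonneg hpos] at hV hξ2
      refine ⟨((cylInv P).1, zOfT ξ), ?_⟩
      have htB : tB (zOfT ξ) = ξ := tB_zOfT ⟨by linarith, by linarith⟩
      rw [T0pre_core_HN (by rwa [htB]), htB, ← TH_zero, TH_zero_eq (lt_of_lt_of_le sqrt_lt_tSw hV) hξ2]
      refine Prod.ext (cylPt_cylInv hξlt) ?_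
      simp only; rw [hwE, hg, hgv]
    · -- south handle type
      rw [abs_of_neg hneg] at hV hξ2
      refine ⟨((cylInv P).1, zOfT ξ), ?_⟩
      have htB : tB (zOfT ξ) = ξ := tB_zOfT ⟨by linarith, by linarith⟩
      rw [T0pre_core_HS (by rw [htB]; linarith), htB, ← handleMap_one_sub', ← TH_zero,
        TH_zero_eq (lt_of_lt_of_le sqrt_lt_tSw hV) hξ2]
      · refine Prod.ext ?_ ?_
        · change mirrorS2 (cylPt (cylInv P).1 (-ξ)) = P
          rw [mirrorS2_cylPt _ ⟨by linarith, by linarith⟩, neg_neg]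
          exact cylPt_cylInv hξlt
        · change IwasePolar.toE ↑((-ξ) ^ 2) = w
          rw [neg_sq, hwE, hg, hgv]
where
  /-- `h (1 - s, ζ, c) = mirror (h (s, ζ, c))` in `mirrorM` form. [folklore] -/
  handleMap_one_sub' {s : ℝ} {ζ : ℂ} {c : ℝ} : mirrorM (handleMap (s, ζ, c)) = handleMap (1 - s, ζ, c) := by
    rw [handleMap_one_sub]; rfl

/-- `t_B (zOfT t) = t` for `t ∈ (-2, 2]` (at `t = 2`, `zOfT 2 = ptB`). [folklore] -/
theorem tB_zOfT' {t : ℝ} (ht : t ∈ Ioc (-2 : ℝ) 2) : tB (zOfT t) = t := by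
  rcases ht.2.lt_or_eq with h | h
  · exact tB_zOfT ⟨ht.1, h⟩
  · subst h
    have : zOfT 2 = ptB := by
      rw [zOfT, show (2 : ℝ) / 4 + 1 = 1 / 2 + 1 by norm_num, circlePt_add_one]; rfl
    rw [this, tB_ptB]

/-- The loop coordinate of a handle parameter `u ∈ (0, 1/2]` lies in `(√(49/50), 2]`. [folklore] -/
theorem loopT_mem {u : ℝ} (hu : u ∈ Ioc (0 : ℝ) (1 / 2)) : loopT u ∈ Ioc (Real.sqrt (49 / 50)) 2 := by
  constructor
  · by_contra h
    push Not at h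
    have := strictMono_loopU.monotone h
    rw [loopU_loopT, loopU_sqrt] at this
    linarith [hu.1]
  · by_contra h
    push Not at h
    have := strictMono_loopU h
    rw [loopU_loopT, loopU_two] at this
    linarith [hu.2]

/-- A north handle core point `h(u, toC z, 0)`, `u ∈ (0, 1/2]`, is a core point of the first torus.
[folklore] -/
theorem handleMap_core_eq_T0pre {u : ℝ} (hu : u ∈ Ioc (0 : ℝ) (1 / 2)) (z₁ : sphere (0 : EuclideanSpace ℝ (Fin 2)) 1) :
    T0pre ((z₁, zOfT (loopT u)), 0) = handleMap (u, toC (z₁ : EuclideanSpace ℝ (Fin 2)), 0) := by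
  obtain ⟨ht1, ht2⟩ := loopT_mem hu
  set t := loopT u with ht
  have hut : loopU t = u := loopU_loopT u
  have hs0 : 0 ≤ Real.sqrt (49 / 50) := Real.sqrt_nonneg _
  have htB : tB (zOfT t) = t := tB_zOfT' ⟨by linarith, ht2⟩
  rcases le_or_gt tSw t with h | h
  · rw [T0pre_core_HN (by rwa [htB]), htB, hut]
  · have habs : |tB (zOfT t)| < tSw := by rw [htB, abs_of_pos (by linarith)]; exact h
    rw [T0pre_core_V habs, htB, ← TH_eq_TV ht1 (zoneV_of_abs_lt (by rwa [htB] at habs)) (by simp [nuMax_pos.le]),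
      TH_zero, hut]

/-- A south handle core point `h(1 - u, toC z, 0)`, `u ∈ (0, 1/2)`, is a core point of the first
torus. [folklore] -/
theorem handleMap_core_eq_T0pre_south {u : ℝ} (hu : u ∈ Ioo (0 : ℝ) (1 / 2)) (z₁ : sphere (0 : EuclideanSpace ℝ (Fin 2)) 1) :
    T0pre ((z₁, zOfT (-loopT u)), 0) = handleMap (1 - u, toC (z₁ : EuclideanSpace ℝ (Fin 2)), 0) := by
  obtain ⟨ht1, ht2⟩ := loopT_mem ⟨hu.1, hu.2.le⟩
  set t := loopT u with ht
  have hut : loopU t = u := loopU_loopT u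
  have ht2' : t < 2 := by
    by_contra h; push Not at h
    have := strictMono_loopU.monotone h
    rw [loopU_two, hut] at this; linarith [hu.2]
  have hs0 : 0 ≤ Real.sqrt (49 / 50) := Real.sqrt_nonneg _
  have htB : tB (zOfT (-t)) = -t := tB_zOfT ⟨by linarith, by linarith⟩
  rcases le_or_gt tSw t with h | h
  · rw [T0pre_core_HS (by rw [htB]; linarith), htB, neg_neg, hut]
  · have habs : |tB (zOfT (-t))| < tSw := by rw [htB, abs_neg, abs_of_pos (by linarith)]; exact h
    have hV : zoneV t := zoneV_of_abs_lt (by rw [abs_of_pos (by linarith)]; exact h)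
    rw [T0pre_core_V habs, htB, TV_neg' hV (by simp [nuMax_pos.le]),
      ← TH_eq_TV ht1 hV (by simp [nuMax_pos.le]), TH_zero, hut, mem_range_of_mem_SigmaN.handleMap_one_sub']

/-- **Points of the handle torus are core points.** [folklore] -/
theorem mem_range_of_mem_SigmaH {q : sphere (0 : EuclideanSpace ℝ (Fin 3)) 1 × EuclideanSpace ℝ (Fin 2)}
    (hq : q ∈ SigmaH) : ∃ x, T0pre (x, 0) = q := by
  obtain ⟨⟨u, ζ, c⟩, ⟨⟨hu, -, -⟩, ⟨hζ, hc⟩⟩, rfl⟩ := hq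
  simp only at hu hζ hc
  subst hc
  set z₁ := IwasePolar.circleOf ζ with hz₁
  have hζ' : toC (z₁ : EuclideanSpace ℝ (Fin 2)) = ζ := IwasePolar.toC_circleOf hζ
  rcases le_or_gt u (1 / 2) with h | h
  · exact ⟨(z₁, zOfT (loopT u)), by rw [handleMap_core_eq_T0pre ⟨hu.1, h⟩, hζ']⟩
  · refine ⟨(z₁, zOfT (-loopT (1 - u))), ?_⟩
    rw [handleMap_core_eq_T0pre_south ⟨by linarith [hu.2], by linarith⟩, hζ', sub_sub_cancel]

/-- **The core of the first torus is exactly the singular torus `Σ₀`.** [folklore] -/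
theorem range_T0pre_core :
    range (fun x : sphere (0 : EuclideanSpace ℝ (Fin 2)) 1 × sphere (0 : EuclideanSpace ℝ (Fin 2)) 1 =>
      T0pre (x, 0)) = Sigma0 := by
  apply Subset.antisymm
  · rintro _ ⟨x, rfl⟩; exact T0pre_core_mem x
  · rintro q (hq | hq)
    · exact mem_range_of_mem_SigmaN hq
    · exact mem_range_of_mem_SigmaH hq

/-- **Off the zero section the pre-map misses `Σ₀`**, on the injectivity tube. [folklore] -/
theorem T0pre_not_mem {ε : ℝ} (hinj : InjOn T0pre (univ ×ˢ ball (0 : EuclideanSpace ℝ (Fin 2)) ε))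
    {x : sphere (0 : EuclideanSpace ℝ (Fin 2)) 1 × sphere (0 : EuclideanSpace ℝ (Fin 2)) 1}
    {v : EuclideanSpace ℝ (Fin 2)} (hv : v ∈ ball (0 : EuclideanSpace ℝ (Fin 2)) ε) (hv0 : v ≠ 0) :
    T0pre (x, v) ∉ Sigma0 := by
  intro hmem
  rw [← range_T0pre_core] at hmem
  obtain ⟨y, hy⟩ := hmem
  have hy' : T0pre (y, 0) = T0pre (x, v) := hy
  have hε : (0 : EuclideanSpace ℝ (Fin 2)) ∈ ball (0 : EuclideanSpace ℝ (Fin 2)) ε := by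
    rw [mem_ball, dist_self]; exact lt_of_le_of_lt dist_nonneg (mem_ball.1 hv)
  have hy0 : ((y, (0 : EuclideanSpace ℝ (Fin 2))) : (sphere (0 : EuclideanSpace ℝ (Fin 2)) 1 ×
      sphere (0 : EuclideanSpace ℝ (Fin 2)) 1) × EuclideanSpace ℝ (Fin 2)) ∈
      univ ×ˢ ball (0 : EuclideanSpace ℝ (Fin 2)) ε := ⟨mem_univ _, hε⟩
  have hxv : ((x, v) : (sphere (0 : EuclideanSpace ℝ (Fin 2)) 1 ×
      sphere (0 : EuclideanSpace ℝ (Fin 2)) 1) × EuclideanSpace ℝ (Fin 2)) ∈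
      univ ×ˢ ball (0 : EuclideanSpace ℝ (Fin 2)) ε := ⟨mem_univ _, hv⟩
  have := hinj hy0 hxv hy'
  rw [Prod.mk.injEq] at this
  exact hv0 this.2.symm

end IwaseTori
end Literature.Topology.FourManifolds
end
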